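import Literature.MathematicalPhysics.QuantumFieldTheory.Balaban1983to89.Node00.HistoryTermsOfRecord
import Literature.MathematicalPhysics.QuantumFieldTheory.Balaban1983to89.Node00.RateRecord11
import Literature.MathematicalPhysics.QuantumFieldTheory.Balaban1983to89.Node00.Record12

/-!
# NODE 00 — DEFINER W1, FILE `RateRecord11W1Reading`: THE W1 READING OF THE RATE-RECORD HOME AT STAGE 11 — node U3's objects
# `U3Objects₁₁` READ FROM THE (2.13) HISTORY TERMS OF RECORD (`Node00/HistoryTermsOfRecord`), per run length, and the
# Literature halves `W1.assignment₁₂ 𝔇` (the ₁₂ home, primary) ∕ `W1.assignment₁₁ 𝔇` of the named rate reading `𝔯_W1` the N18 ∕ N22 faces name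

Cell `pub-ymgap`, NODE 00, definer seat `pub-ymgap-node00-def-W1` (gen 2; director R134 (c)).  The ONE remaining definer-lane object both N22
consumers name (dag-n22-e CLOSE, pub-ymgap INBOX l.12872: «a NAMED W1 reading `𝔯_W1` (Literature instance: `U3Objects₁₁.ofFixed (W1.histCarriers …)
(W1.functional …) EB ℓ` per run length + N18's pairing `EB`)»; dag-n22-c CLOSE l.12901 (i); RR-1's layer A `Node00/RateRecord11` §6 «pinned later BY
NAME (W1's functional → `u3.EA ∕ u3.EB`)»; dag-n18-d module 5 §6 `n18At_u3OfRecord₁₁_histCarriers_iff` = N18 «in the definer's currency»).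
[I] = [Balaban1987RG1] (held `paper:balaban1987-cmp109-rg-i-small-field`, journal page = PDF page + 248), [II] = [Balaban1988RG2Cluster] (held
`paper:balaban1988-cmp116-rg-ii-cluster`), [LF-II] = [Balaban1989LargeFieldII].  Displays this file reads (verbatim, re-read on the text layers by gen 0,
INBOX l.12155 ∕ the W1 file's header): [I] (0.24)–(0.25) p.257 (the localized terms `E^{(j)}(X, …)`, `X ∈ 𝐃_j`, of the effective action after `k`
steps — run A — and after `k + 1` steps — run B), (1.18) p.263 «|E^{(j)}(X, g_{j−1}, 𝐔, 𝐉)| ≤ E₀ exp(−κ d_j(X))», §0 p.256 «The function E_k depends also on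
the effective coupling constants g₀, …, g_{k−1}»; [II] (2.13) p.14 «E^{(k+1)}(X) = Σ_{n=1}^∞ (1∕n!) Σ_{(Z₁,…,Z_n): ∪Z_i = X} ρ^T(Z₁,…,Z_n)H(Z₁)⋯H(Z_n)»;
[LF-II] (2.13)–(2.14) p.359 (the objects the rate letters of layer A are keyed to).  NOTHING printed is asserted here; the two-run PAIRING (which
run-B domain and background answer to run A's `(j, X)`, `U`) is NOT PRINTED anywhere ([I] Thm 1 p.259 states the flow, not an η-rate) and is recorded as DATA.

WHAT THIS FILE TYPES (hypothesis-schema, total definitions, `rfl` ∕ `Iff.rfl` faces; D-0064 one module; imports W1's object file, RR-1's layer A and def-T's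
`Node00/Record12` (for `Stage12Params`) only).
The rate-record home (layer A `Node00/RateRecord11.lean` + RR-2's ₁₂ key, layer B `Summits/…/BalabanUVNodesRateCarriersOfRecord11 ∕ 12.lean`) reads, per
construction `(F, θ, g₀, os)`, node U3's objects `U3Objects₁₁ = (levelCarriers k, EA k, EB k)_k + the K-uniform letter block (κ θ₅ C₅ C₉ ω cr ρ)` from a RESIDUAL
assignment `𝔯.lit : RateAssignment₁₁ N`.  The bundle of RUN LENGTH `k` compares run A = the run of `k` steps, on the `k`-th torus `F.P k`
(`T4Continuum`: spacing `L^{−k}`), with run B = the run of `k + 1` steps on `F.P (k+1)` ([I] (0.24)–(0.25)).  In W1's currency run A's level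
functional IS `(g, U, ⟨j, X⟩) ↦ Re E^{(j)}(X; g₀,…,g_{j−1}; embA U)` — (2.13) AS A DEFINITION, `W1.functionalOn (S k) …` on the carriers of record
`W1.histCarriers (F.P k) M …` of the `k`-th torus — and run B's first-coupling family IS `(b, g, U, ⟨j, X⟩) ↦ Re E_B(π⟨j, X⟩; b∷g; embB U)`, the (2.13) terms
of the `(k+1)`-run read through the pairing (dag-n18-d §6's literal).  So:
* §1 `LevelPairing F 𝔸 M k` — the UNPRINTED level-`k` pairing data AS DATA (run-A ∕ run-B background types `BgA ∕ BgB` «restricted to the domains of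
  definition» (`T4OutputRate.Carriers`), closeness gauge, transport `BgB → BgA`, the readings `embA : BgA → Φ(F.P k)`, `embB : BgB → Φ(F.P (k+1))` in the
  complex configuration spaces of record `Sect2.CPair`, the domain pairing `pair : (j, X) ↦` run B's domain); its `toRunPairing` (W1's `RunPairing`
  literal `⟨BgA, BgB, gauge, _, transport⟩`), `carriers := W1.histCarriers (F.P k) M toRunPairing`, `EA S := W1.functionalOn S toRunPairing embA`,
  `EB S′ b g U X := Re (W1.functionalC S′ (prependCoupling b g) (embB U) (pair X))`; the RUN-A SIDE OF RECORD `LevelPairing.ofRecordA` (`BgA := SU(N)` gauge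
  fields on the fine lattice of `F.P k`, `embA := Sect2.ofBackgroundC (ιSU N)`, `𝐉 = 0`), for which `EA = W1.functional S (ιSU N) _` (`rfl`).
* §2 `LetterInputs` — the K-UNIFORM letter inputs (ONE block per construction, never a function of the run length: `κ θ₅ C₅` of N18's NE5, `cr ρ` of N17 ∕
  (D4), and the regularity slot's constants `C₀ A μ r s`) and the letter blocks they DEFINE: `LetterInputs.analytic γ` with
  `ω := θ₅^{1−s} μ^{s}`, `C₉ := (32 ∕ (s²·min(r∕2, γ∕2)))·C₀^{1−s}(2A)^{s} ∕ (θ₅^{1−s} μ^{s})` — EXACTLY the letter equations of the analytic slot (A) of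
  `…N22AtRateRecord11Slots.s_N22_rRec₁₁_of_oscAnalytic` (RR-1 fixed the moduli shape `C₉·ω^{k−i}` of that slot), so that they hold BY `rfl` for the reading —
  and the strip variant `LetterInputs.strip γ` (`2(A·r)` for `2A`, slot (A′)); `Signs` from displayed sign hypotheses on the inputs (`signs_analytic`).
* §3 `ReadingData F 𝔸 M` — THE W1 READING DATA OF ONE CONSTRUCTION: the towers of one-step cluster data `S k : W1.ClusterTower (F.P k) 𝔸 M` of the run of
  length `k` (its (2.14) terms = N10's Lemmas 1–3 objects: DATA, exactly as in W1's object file), the level pairings, the letter inputs; and THE U3 OBJECTS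
  OF THE READING `ReadingData.u3Objects D γ : U3Objects₁₁ := { D.li.analytic γ with levelCarriers k := (D.pairing k).carriers, EA k := (D.pairing k).EA (D.S k),
  EB k := (D.pairing k).EB (D.S (k+1)) }` — a PER-RUN-LENGTH family (the carriers of run length `k` are the `k`-th torus's; at each level `k` it agrees
  field for field, by `rfl`, with the fixed-carrier objects `U3Objects₁₁.ofFixed (D.pairing k).carriers ((D.pairing k).EA (D.S k)) ((D.pairing k).EB
  (D.S (k+1))) (D.li.analytic γ)` at level `k`, hence so do layer B's bundles `u3OfRecord₁₁ θ · k`, which read level `k` only).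
* §4 THE KEYED ASSIGNMENTS — the Literature half of the named reading `𝔯_W1` at BOTH homes: `AssignmentInputs₁₂ N` ∕ `W1.assignment₁₂ 𝔇 : (F : T4Family) →
  Stage12Params F N → (ℕ → ℝ) → List (ULoop F) → RateObjects₁₁ N` (PRIMARY — the ₁₂ home of `Node00/Record12`, where content lives; the value type is RR-2's
  proviso-free `RateAssignment₁₂ N` spelled out, embedded in layer B ₁₂ by `RateReading₁₂.ofAssignment`; NO proviso is read by W1's data) and
  `AssignmentInputs₁₁ N` ∕ `W1.assignment₁₁ 𝔇 : RateAssignment₁₁ N` (the ₁₁ home, for the ₁₁ consumer modules as they stand; its datum keys are uninhabited,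
  `Node00.not_isRecordOfRecord₁₁C`, so its node statements are located-vacuous).  Per `(F, θ)` the inputs carry the reading data on `𝔸 = M_N(ℂ)` (`MatA N`)
  with the cube size OF THE RECORD `M = θ.τ9.M` (as `Node00/Record11 ∕ Record12`'s `Sect2.domSys (F.P p.K) θ.τ9.M j`) and the window radius `θ.γ` enters
  the letters; per `(F, θ, g₀, os)` N16's and N15's single-scale objects `ne3 ∕ ne2` (NOT W1's: residual, their definers' pins) —
  `W1.assignment₁₂ 𝔇 F θ g₀ os := ⟨(𝔇.w1 F θ).u3Objects θ.γ, 𝔇.ne3 F θ g₀ os, 𝔇.ne2 F θ g₀ os⟩`.  (The dressed tower `ne1` is Summits-typed, NODE O's.)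
* §5 FACES (`rfl` ∕ `Iff.rfl`) and PROVED GLUE on both assignments: `assignment₁₂_u3 ∕ _levelCarriers ∕ _EA ∕ _EA_apply ∕ _EB_apply ∕ _toU3Letters₁₁ ∕ _moduli`;
  THE LETTER EQUATIONS `assignment₁₂_ω : u3.ω = u3.θ₅ ^ (1 − s) * μ ^ s`, `assignment₁₂_C₉ : u3.C₉ = 32 ∕ (s² · min (r∕2) (θ.γ∕2)) * (C₀^(1−s) * (2A)^s) ∕
  (u3.θ₅^(1−s) * μ^s)` (`rfl`, the analytic slot's literals); (P) `prefixDependenceOn_assignment₁₂_EA` — `T4OutputRate.PrefixDependenceOn (u3.EA k) W` for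
  EVERY window, NO HYPOTHESIS (W1's `functionalOn_prefixDependenceOn`); `scaleZeroFree_assignment₁₂_EA`; `assignment₁₂_u3_populated` (UNCONDITIONAL) and
  `assignment₁₂_populated_iff`; THE NE5 ∕ NE9 READINGS `ne5_assignment₁₂_iff`, `ne9_assignment₁₂_iff` (`Iff.rfl`): `T4OutputRate.NE5 (u3.EA k) (u3.EB k b) W
  u3.κ u3.θ₅ u3.C₅` IS «∀ g ∈ W, ∀ U (j, X), |Re E_A^{(j)}(X; g; embA (transport U)) − Re E_B(pair (j,X); b∷g; embB U)| ≤ C₅·θ₅^j·e^{−κ d_j(X)}}»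
  (dag-n18-d §6's right-hand side, keyed per run length); the same list at ₁₁ (`assignment₁₁_…`, `ne5_assignment₁₁_iff`).
* §6 HONESTY IN THE KERNEL: the termless tower `termlessTower` (`H ≡ 0`) has vanishing (2.13) functional (`E_termlessTower`, `functionalC_termlessTower`, via
  `Φ^T(C; 0) = 0`), whence `exists_assignmentInputs₁₂_populated_functionals_zero` — an input datum whose ₁₂ assignment has a POPULATED U3 layer and
  `EA k ≡ 0`, `EB k b ≡ 0` at every key, hence NE5 (own letters, every `b`, every window) and NE9 (every window, rate and non-negative moduli) with
  nothing proved: INHABITATION (and populatedness) IS NOT CONTENT; class consistency `nonempty_assignmentInputs₁₂ ∕ ₁₁`,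
  `nonempty_readingData`.

## HONEST FRAMING — what this is NOT

* A READING (pins of SHAPE), hypothesis-schema, kernel bookkeeping.  NOTHING of Bałaban's is asserted: no estimate (NE5 ∕ NE9 ∕ (2.38) ∕ (1.18) are the
  consumers' statements ABOUT these objects, NOT PRINTED for d = 4 as rates, NOT proved); no node discharged; counts unmoved; `--supports` count-neutral.
* LOCATED, NOT CONTENT (ref-H WATCH-W1-DEGENERATE, STATUS l.6680, applies verbatim one level down): the towers `S k` — the VALUES of the (2.14) terms — are
  RESIDUAL inputs (`𝔇.w1 F θ |>.S`), as are the pairing maps and the letter inputs; N10's Lemmas 1–3 objects (Gaussian integrals, `χ`, `Γ_k(Z₀, σ(Z))`, `𝐕_k`)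
  do not exist as Lean objects, and the bridge to `Node00/Record11`'s EXISTENTIAL §2-form terms (`Sect2.TermValues` under `SLaw₁₁`) is NOT made here.  Hence
  `S_N18 ∕ S_N22 (RRec₁₂ (RateReading₁₂.ofAssignment (W1.assignment₁₂ 𝔇) ne1))` are statements about `𝔇`'s towers: contentful for towers pinned to the
  (2.14) terms, trivially true for the termless tower (§6 `exists_assignmentInputs₁₂_populated_functionals_zero`; dag-n18-d's `s_N18_rRec₁₁_of_null`
  pattern) — a skeleton quoting them NAMES its `𝔇`; and at the ₁₁ home they are located-vacuous outright (`Node00.not_isRecordOfRecord₁₁C`).  What the reading DOES fix by type: the carriers of run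
  length `k` are the `k`-th torus's catalogue of record (`Sect2.domSys (F.P k) θ.τ9.M j`, creation step, torus tree length), run A's functional is (2.13) of
  `S k`'s activities read through `embA` (prefix-typed: (P) is a theorem), run B's family is (2.13) of `S (k+1)` through the pairing with the first coupling
  prepended, the letters are ONE block per construction in the analytic-slot shape, the window is layer B's `]0, θ.γ]`.
* The pairing data, `embA ∕ embB`, and the letters `C₉ ω` are NOT PRINTED objects (programme bookkeeping: `T4OutputRate`, RR-1 §2, N22 module 4).
* One finite four-torus programme at fixed `ε`, Bałaban as printed — NOT the continuum limit on ℝ⁴, NOT infinite volume, NOT OS, NOT a mass gap, NOT Clay.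
* No `sorry`, no `axiom`, no `instance`, no `notation`; `Summits/` is not imported (layer B's `RateReading₁₁ ∕ u3OfRecord₁₁ ∕ RRec₁₁` are the consumers').
-/

noncomputable section

open scoped BigOperators

namespace Literature.MathematicalPhysics.QuantumFieldTheory.Balaban1983to89.Node00

open Literature.MathematicalPhysics.QuantumFieldTheory.Balaban1983to89
open T4Continuum Sect2
open Literature.MathematicalPhysics.QuantumFieldTheory.Balaban1983to89.T4OutputRate (Carriers Functional Window NE5 NE9 PrefixDependenceOn)
open Literature.MathematicalPhysics.QuantumFieldTheory.Balaban1983to89.T4HistoryLipschitzRecursion (ScaleZeroFree)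

namespace W1

/-! ## §1  The UNPRINTED level-`k` pairing data of the reading (run A on `F.P k`, run B on `F.P (k+1)`) -/

/-- **THE LEVEL-`k` PAIRING DATA OF THE W1 READING** (UNPRINTED conventions, recorded as DATA): run A = the run of `k` steps on the `k`-th torus `F.P k`,
run B = the run of `k + 1` steps on `F.P (k + 1)` ([I] (0.24)–(0.25)); the run-A ∕ run-B background types (understood as already restricted to the domains
of definition, `T4OutputRate.Carriers`), the closeness gauge on run-A backgrounds, the one-step transport `T₀ : BgB → BgA` run B → run A, the READINGS of
the backgrounds in the complex configuration spaces `Φ` of record of the two tori (`Sect2.CPair`), and the DOMAIN PAIRING `(j, X) ↦` run B's localization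
domain answering to it (same physical extent: run B's creation step `j + 1` on `F.P (k+1)` has run A's step-`j` lattice spacing).  «FIX T₀ AND SAY SO»
(lens card T1 (a)): the transport is FIXED BY THIS FIELD — whichever map the reading's data name IS the T₀ of the reading; the record INTENDS the one-step
block averaging of run B's fine background to run A's fine lattice ([I] (0.8)–(0.10) p.253, the averaging of the first of run B's `k + 1` steps; Summits-typed
as dag-n18-d's `transportRaw F K (blockAvg expMeanLogSU)`, hence not pinned in `Literature/`), and by `YMDAG.N18.TransportSwap` (p460812) N18 at the home is
insensitive to the identification at a booked coherence price.  Nothing about these maps is assumed.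
[cite: Balaban1987RG1, (0.8)-(0.10) p.253, (0.24)-(0.25) p.257 and Thm 1 p.259 (two runs; the pairing is NOT printed)] -/
structure LevelPairing (F : T4Family) (𝔸 : Type*) (M k : ℕ) where
  /-- run-A backgrounds -/
  BgA : Type
  /-- run-B backgrounds -/
  BgB : Type
  /-- closeness gauge on run-A backgrounds -/
  gauge : BgA → BgA → ℝ
  gauge_nonneg : ∀ U U', 0 ≤ gauge U U'
  /-- background transport run B → run A -/
  transport : BgB → BgA
  /-- reading of run-A backgrounds in `Φ(F.P k)` -/
  embA : BgA → CPair (F.P k) 𝔸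
  /-- reading of run-B backgrounds in `Φ(F.P (k+1))` -/
  embB : BgB → CPair (F.P (k + 1)) 𝔸
  /-- domain pairing: run A's `(j, X)` ↦ run B's domain -/
  pair : W1.Dom (F.P k) M → W1.Dom (F.P (k + 1)) M

namespace LevelPairing

variable {F : T4Family} {𝔸 : Type*} {M k : ℕ} (R : LevelPairing F 𝔸 M k)

/-- The W1 two-run pairing literal `⟨BgA, BgB, gauge, _, transport⟩` of the level data. [cite: Balaban1987RG1, (0.24)-(0.25) p.257 (bookkeeping)] -/
def toRunPairing : RunPairing :=
  ⟨R.BgA, R.BgB, R.gauge, R.gauge_nonneg, R.transport⟩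

/-- **THE LEVEL-`k` PAIR CARRIERS OF THE READING**: W1's carriers of record of the `k`-th torus (domains of all creation steps `Σ j, 𝐃_j(F.P k)`, creation
step, torus tree length) with the level pairing. [cite: Balaban1987RG1, (0.24)-(0.25) p.257] -/
def carriers : Carriers :=
  histCarriers (F.P k) M R.toRunPairing

/-- **RUN A's LEVEL FUNCTIONAL OF THE READING**: `(g, U, ⟨j, X⟩) ↦ Re E^{(j)}(X; g₀,…,g_{j−1}; embA U)` — (2.13) of the tower `S`'s activities, W1's
`functionalOn`. [cite: Balaban1988RG2Cluster, (2.13) p.14; Balaban1987RG1, (0.24) p.257 and (1.18) p.263] -/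
def EA (S : ClusterTower (F.P k) 𝔸 M) : Functional R.carriers R.BgA :=
  functionalOn S R.toRunPairing R.embA

/-- **RUN B's FIRST-COUPLING FAMILY OF THE READING**: `(b, g, U, ⟨j, X⟩) ↦ Re E_B(pair ⟨j, X⟩; b∷g; embB U)` — (2.13) of run B's tower `S′` (the run of `k + 1`
steps) at the paired domain, the history re-indexed with run B's unpaired first coupling `b` PREPENDED (`Node00.prependCoupling`), the run-B background read
through `embB` (dag-n18-d §6's literal). [cite: Balaban1988RG2Cluster, (2.13) p.14; Balaban1987RG1, (0.24)-(0.25) p.257] -/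
def EB (S' : ClusterTower (F.P (k + 1)) 𝔸 M) : ℝ → Functional R.carriers R.BgB :=
  fun b g U X => (functionalC S' (prependCoupling b g) (R.embB U) (R.pair X)).re

/-- Face: the carriers' domains are W1's `Σ j, 𝐃_j(F.P k)`. [cite: Balaban1987RG1, (0.24) p.257 (bookkeeping)] -/
theorem carriers_Dom : R.carriers.Dom = W1.Dom (F.P k) M := rfl

/-- Face: the creation step of `(j, X)` is `j`. [cite: Balaban1987RG1, (0.24) p.257 (bookkeeping)] -/
@[simp] theorem carriers_scale (X : W1.Dom (F.P k) M) : R.carriers.scale X = X.1 := rfl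

/-- Face: the linear size of `(j, X)` is `d_j(X)` of record. [cite: Balaban1987RG1, p.257 (d_j(X); bookkeeping)] -/
@[simp] theorem carriers_d (X : W1.Dom (F.P k) M) : R.carriers.d X = (domSys (F.P k) M X.1).dj X.2 := rfl

/-- Face: the run-A backgrounds of the carriers. [cite: Balaban1987RG1, (0.24)-(0.25) p.257 (bookkeeping)] -/
theorem carriers_BgA : R.carriers.BgA = R.BgA := rfl

/-- Face: the run-B backgrounds of the carriers. [cite: Balaban1987RG1, (0.24)-(0.25) p.257 (bookkeeping)] -/
theorem carriers_BgB : R.carriers.BgB = R.BgB := rfl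

/-- Face: the transport of the carriers. [cite: Balaban1987RG1, §1 p.263 (bookkeeping)] -/
theorem carriers_transport : R.carriers.transport = R.transport := rfl

/-- Face: `EA S = W1.functionalOn S _ embA`. [cite: Balaban1988RG2Cluster, (2.13) p.14 (bookkeeping)] -/
theorem EA_eq (S : ClusterTower (F.P k) 𝔸 M) : R.EA S = functionalOn S R.toRunPairing R.embA := rfl

/-- Face: `EA S g U ⟨j, X⟩ = Re E^{(j)}(X; g; embA U)`. [cite: Balaban1988RG2Cluster, (2.13) p.14 (bookkeeping)] -/
theorem EA_apply (S : ClusterTower (F.P k) 𝔸 M) (g : ℕ → ℝ) (U : R.BgA) (X : W1.Dom (F.P k) M) :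
    R.EA S g U X = (functionalC S g (R.embA U) X).re := rfl

/-- Face: `EB S′ b g U X = Re E_B(pair X; b∷g; embB U)`. [cite: Balaban1988RG2Cluster, (2.13) p.14 (bookkeeping)] -/
theorem EB_apply (S' : ClusterTower (F.P (k + 1)) 𝔸 M) (b : ℝ) (g : ℕ → ℝ) (U : R.BgB) (X : W1.Dom (F.P k) M) :
    R.EB S' b g U X = (functionalC S' (prependCoupling b g) (R.embB U) (R.pair X)).re := rfl

end LevelPairing

/-- **THE RUN-A SIDE OF RECORD at level `k`**: run-A backgrounds = the `SU(N)`-valued gauge fields on the fine lattice of the `k`-th torus, read in `Φ` through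
`ιSU N : SU(N) →* M_N(ℂ)ˣ` with `𝐉 = 0` (`Sect2.ofBackgroundC`, the reading of `Node00/Record11`'s `one_mem_spaceI_stage11`); the run-B side and the pairing
maps stay data. [cite: Balaban1987RG1, pp.251-252 and (0.24) p.257] -/
def LevelPairing.ofRecordA {F : T4Family} (N : ℕ) {M : ℕ} (k : ℕ) (BgB : Type)
    (gauge : GaugeField (F.P k) 0 (SU N) → GaugeField (F.P k) 0 (SU N) → ℝ) (hg : ∀ U U', 0 ≤ gauge U U')
    (transport : BgB → GaugeField (F.P k) 0 (SU N)) (embB : BgB → CPair (F.P (k + 1)) (MatA N))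
    (pair : W1.Dom (F.P k) M → W1.Dom (F.P (k + 1)) M) : LevelPairing F (MatA N) M k :=
  ⟨GaugeField (F.P k) 0 (SU N), BgB, gauge, hg, transport, ofBackgroundC (ιSU N), embB, pair⟩

/-- For the run-A side of record, run A's level functional IS W1's functional of record `W1.functional S (ιSU N) _` (`rfl`).
[cite: Balaban1987RG1, (0.24) p.257 and (1.18) p.263 (bookkeeping)] -/
theorem LevelPairing.EA_ofRecordA {F : T4Family} (N : ℕ) {M : ℕ} (k : ℕ) (BgB : Type)
    (gauge : GaugeField (F.P k) 0 (SU N) → GaugeField (F.P k) 0 (SU N) → ℝ) (hg : ∀ U U', 0 ≤ gauge U U')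
    (transport : BgB → GaugeField (F.P k) 0 (SU N)) (embB : BgB → CPair (F.P (k + 1)) (MatA N))
    (pair : W1.Dom (F.P k) M → W1.Dom (F.P (k + 1)) M) (S : ClusterTower (F.P k) (MatA N) M) :
    (LevelPairing.ofRecordA N k BgB gauge hg transport embB pair).EA S =
      functional S (ιSU N) (LevelPairing.ofRecordA N k BgB gauge hg transport embB pair).toRunPairing := rfl

/-! ## §2  The K-uniform letter inputs and the letter blocks they define (analytic slot of record; strip variant) -/

/-- **THE LETTER INPUTS OF THE READING** — ONE record per construction (K-uniform BY TYPE: no run-length argument exists): the decay letter `κ`, N18's NE5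
rate `θ₅` and constant `C₅`, the read-out domination `cr` and joint rate `ρ` of N17 ∕ (D4), and the constants of the regularity slot the N22 closers
read — oscillation constant `C₀`, amplitude `A` (sup letter `M` of slot (A), derivative letter `L` of slot (A′)), rate `μ`, disc radius `r`, interpolation
exponent `s`. [cite: Balaban1987RG1, (1.20)-(1.22) p.264 (hypothesis dictionary; letters only)] -/
structure LetterInputs where
  /-- decay letter `κ` -/
  κ : ℝ
  /-- NE5 rate `θ₅` -/
  θ₅ : ℝ
  /-- NE5 constant `C₅` -/
  C₅ : ℝ
  /-- read-out domination constant `cr` -/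
  cr : ℝ
  /-- joint rate `ρ` -/
  ρ : ℝ
  /-- oscillation constant `C₀` of (O) -/
  C₀ : ℝ
  /-- amplitude of the regularity letter (`M` of slot (A), `L` of slot (A′)) -/
  A : ℝ
  /-- rate `μ` of the regularity letter -/
  μ : ℝ
  /-- disc radius `r` -/
  r : ℝ
  /-- interpolation exponent `s ∈ ]0, 1[` -/
  s : ℝ

namespace LetterInputs

variable (li : LetterInputs) (γ : ℝ)

/-- **THE LETTER BLOCK OF THE ANALYTIC SLOT (A)** at window radius `γ`: `ω := θ₅^{1−s} μ^{s}`,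
`C₉ := (32 ∕ (s²·min(r∕2, γ∕2)))·(C₀^{1−s}(2A)^{s}) ∕ (θ₅^{1−s} μ^{s})` — the letter equations of `YMDAG.N22.s_N22_rRec₁₁_of_oscAnalytic` as DEFINITIONS.
[cite: Balaban1989LargeFieldII, (2.13)-(2.14) p.359 (objects the letters are keyed to; the formulas are programme bookkeeping)] -/
def analytic : U3Letters₁₁ where
  κ := li.κ
  θ₅ := li.θ₅
  C₅ := li.C₅
  C₉ := 32 / (li.s ^ 2 * min (li.r / 2) (γ / 2)) * (li.C₀ ^ (1 - li.s) * (2 * li.A) ^ li.s) / (li.θ₅ ^ (1 - li.s) * li.μ ^ li.s)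
  ω := li.θ₅ ^ (1 - li.s) * li.μ ^ li.s
  cr := li.cr
  ρ := li.ρ

/-- **THE LETTER BLOCK OF THE STRIP SLOT (A′)**: as `analytic` with `2(A·r)` for `2A` (the letter equations of `YMDAG.N22.s_N22_rRec₁₁_of_oscStrip`).
[cite: Balaban1989LargeFieldII, (2.13)-(2.14) p.359 (objects; formulas are programme bookkeeping)] -/
def strip : U3Letters₁₁ where
  κ := li.κ
  θ₅ := li.θ₅
  C₅ := li.C₅
  C₉ := 32 / (li.s ^ 2 * min (li.r / 2) (γ / 2)) * (li.C₀ ^ (1 - li.s) * (2 * (li.A * li.r)) ^ li.s) / (li.θ₅ ^ (1 - li.s) * li.μ ^ li.s)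
  ω := li.θ₅ ^ (1 - li.s) * li.μ ^ li.s
  cr := li.cr
  ρ := li.ρ

/-- Face: `(analytic).κ = κ`. [cite: Balaban1987RG1, (1.20)-(1.22) p.264 (bookkeeping)] -/
@[simp] theorem analytic_κ : (li.analytic γ).κ = li.κ := rfl
/-- Face: `(analytic).θ₅ = θ₅`. [cite: Balaban1987RG1, (1.20)-(1.22) p.264 (bookkeeping)] -/
@[simp] theorem analytic_θ₅ : (li.analytic γ).θ₅ = li.θ₅ := rfl
/-- Face: `(analytic).C₅ = C₅`. [cite: Balaban1987RG1, (1.20)-(1.22) p.264 (bookkeeping)] -/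
@[simp] theorem analytic_C₅ : (li.analytic γ).C₅ = li.C₅ := rfl
/-- Face: `(analytic).cr = cr`. [cite: Balaban1987RG1, (1.20)-(1.22) p.264 (bookkeeping)] -/
@[simp] theorem analytic_cr : (li.analytic γ).cr = li.cr := rfl
/-- Face: `(analytic).ρ = ρ`. [cite: Balaban1987RG1, (1.20)-(1.22) p.264 (bookkeeping)] -/
@[simp] theorem analytic_ρ : (li.analytic γ).ρ = li.ρ := rfl

/-- THE LETTER EQUATION FOR `ω` (slot (A)'s `hω`, on the block's own `θ₅`). [cite: Balaban1989LargeFieldII, (2.13)-(2.14) p.359 (bookkeeping)] -/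
theorem analytic_ω : (li.analytic γ).ω = (li.analytic γ).θ₅ ^ (1 - li.s) * li.μ ^ li.s := rfl

/-- THE LETTER EQUATION FOR `C₉` (slot (A)'s `hC₉`, on the block's own `θ₅`). [cite: Balaban1989LargeFieldII, (2.13)-(2.14) p.359 (bookkeeping)] -/
theorem analytic_C₉ :
    (li.analytic γ).C₉ = 32 / (li.s ^ 2 * min (li.r / 2) (γ / 2)) * (li.C₀ ^ (1 - li.s) * (2 * li.A) ^ li.s) / ((li.analytic γ).θ₅ ^ (1 - li.s) * li.μ ^ li.s) :=
  rfl

/-- THE LETTER EQUATION FOR `ω`, strip slot. [cite: Balaban1989LargeFieldII, (2.13)-(2.14) p.359 (bookkeeping)] -/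
theorem strip_ω : (li.strip γ).ω = (li.strip γ).θ₅ ^ (1 - li.s) * li.μ ^ li.s := rfl

/-- THE LETTER EQUATION FOR `C₉`, strip slot. [cite: Balaban1989LargeFieldII, (2.13)-(2.14) p.359 (bookkeeping)] -/
theorem strip_C₉ :
    (li.strip γ).C₉ =
      32 / (li.s ^ 2 * min (li.r / 2) (γ / 2)) * (li.C₀ ^ (1 - li.s) * (2 * (li.A * li.r)) ^ li.s) / ((li.strip γ).θ₅ ^ (1 - li.s) * li.μ ^ li.s) :=
  rfl

/-- **THE DISPLAYED SIGNS OF THE ANALYTIC BLOCK FROM SIGNS OF THE INPUTS** (repackaging; the two clauses on `ω, C₉` are stated on their formulas).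
[cite: Balaban1987RG1, (1.20)-(1.22) p.264 (hypothesis dictionary)] -/
theorem signs_analytic (hκ : 0 ≤ li.κ) (hθ0 : 0 < li.θ₅) (hθ1 : li.θ₅ < 1) (hC₅ : 0 ≤ li.C₅)
    (hC₉ : 0 ≤ 32 / (li.s ^ 2 * min (li.r / 2) (γ / 2)) * (li.C₀ ^ (1 - li.s) * (2 * li.A) ^ li.s) / (li.θ₅ ^ (1 - li.s) * li.μ ^ li.s))
    (hω0 : 0 ≤ li.θ₅ ^ (1 - li.s) * li.μ ^ li.s) (hω1 : li.θ₅ ^ (1 - li.s) * li.μ ^ li.s < 1) (hcr : 0 ≤ li.cr) (hθρ : li.θ₅ ≤ li.ρ)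
    (hωρ : li.θ₅ ^ (1 - li.s) * li.μ ^ li.s ≤ li.ρ) (hρ : li.ρ < 1) : (li.analytic γ).Signs :=
  ⟨hκ, hθ0, hθ1, hC₅, hC₉, hω0, hω1, hcr, hθρ, hωρ, hρ⟩

/-- With `0 < θ₅ < 1`, `0 < μ ≤ 1` and `0 < s < 1` the analytic block's rate `ω = θ₅^{1−s} μ^{s}` lies in `]0, 1[` (the case of the activity-side letter,
`μ = 1`). [cite: Balaban1987RG1, (1.20)-(1.22) p.264 (bookkeeping)] -/
theorem analytic_ω_pos_lt_one (hθ0 : 0 < li.θ₅) (hθ1 : li.θ₅ < 1) (hμ0 : 0 < li.μ) (hμ1 : li.μ ≤ 1) (hs0 : 0 < li.s) (hs1 : li.s < 1) :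
    0 < (li.analytic γ).ω ∧ (li.analytic γ).ω < 1 := by
  refine ⟨mul_pos (Real.rpow_pos_of_pos hθ0 _) (Real.rpow_pos_of_pos hμ0 _), ?_⟩
  have h1 : li.θ₅ ^ (1 - li.s) < 1 := Real.rpow_lt_one hθ0.le hθ1 (by linarith)
  have h2 : li.μ ^ li.s ≤ 1 := Real.rpow_le_one hμ0.le hμ1 hs0.le
  have h3 : 0 < li.μ ^ li.s := Real.rpow_pos_of_pos hμ0 _
  calc (li.analytic γ).ω = li.θ₅ ^ (1 - li.s) * li.μ ^ li.s := rfl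
    _ < 1 * 1 := by nlinarith
    _ = 1 := one_mul 1

end LetterInputs

/-! ## §3  The W1 reading data of one construction and its U3 objects -/

/-- **THE W1 READING DATA OF ONE CONSTRUCTION** (family `F`, coefficient algebra `𝔸`, cube size `M`), RESIDUAL: for every run length `k` the tower of
one-step cluster data `S k` of the run of `k` steps on the `k`-th torus (its (2.14) terms are DATA — N10's Lemmas 1–3 objects — exactly as in W1's
object file) and the level pairing; the K-uniform letter inputs. [cite: Balaban1988RG2Cluster, (2.13)-(2.14) pp.14-15; Balaban1987RG1, (0.24)-(0.25) p.257] -/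
structure ReadingData (F : T4Family) (𝔸 : Type*) (M : ℕ) where
  /-- the tower of one-step cluster data of the run of length `k` -/
  S : (k : ℕ) → ClusterTower (F.P k) 𝔸 M
  /-- the level-`k` pairing data -/
  pairing : (k : ℕ) → LevelPairing F 𝔸 M k
  /-- the K-uniform letter inputs -/
  li : LetterInputs

namespace ReadingData

variable {F : T4Family} {𝔸 : Type*} {M : ℕ} (D : ReadingData F 𝔸 M) (γ : ℝ)

/-- **THE U3 OBJECTS OF THE W1 READING** at window radius `γ`: level carriers = the `k`-th torus's carriers of record with the level pairing, `EA k` = (2.13) of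
`S k` read through `embA`, `EB k` = (2.13) of `S (k+1)` through the pairing with the first coupling prepended, letters = the analytic block of the inputs —
a PER-RUN-LENGTH family agreeing at each level `k`, field for field by `rfl`, with `U3Objects₁₁.ofFixed (D.pairing k).carriers ((D.pairing k).EA (D.S k))
((D.pairing k).EB (D.S (k+1))) (D.li.analytic γ)` at level `k`. [cite: Balaban1987RG1, (0.24)-(0.25) p.257 and (1.18) p.263; Balaban1988RG2Cluster, (2.13) p.14] -/
def u3Objects : U3Objects₁₁ :=
  { D.li.analytic γ with
    levelCarriers := fun k => (D.pairing k).carriers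
    EA := fun k => (D.pairing k).EA (D.S k)
    EB := fun k => (D.pairing k).EB (D.S (k + 1)) }

/-- Face: the level-`k` carriers. [cite: Balaban1987RG1, (0.24)-(0.25) p.257 (bookkeeping)] -/
theorem u3Objects_levelCarriers (k : ℕ) : (D.u3Objects γ).levelCarriers k = histCarriers (F.P k) M (D.pairing k).toRunPairing := rfl

/-- Face: `EA k = W1.functionalOn (S k) _ embA`. [cite: Balaban1988RG2Cluster, (2.13) p.14 (bookkeeping)] -/
theorem u3Objects_EA (k : ℕ) : (D.u3Objects γ).EA k = functionalOn (D.S k) (D.pairing k).toRunPairing (D.pairing k).embA := rfl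

/-- Face: `EA k g U ⟨j, X⟩ = Re E^{(j)}(X; g; embA U)`. [cite: Balaban1988RG2Cluster, (2.13) p.14 (bookkeeping)] -/
theorem u3Objects_EA_apply (k : ℕ) (g : ℕ → ℝ) (U : (D.pairing k).BgA) (X : W1.Dom (F.P k) M) :
    (D.u3Objects γ).EA k g U X = (functionalC (D.S k) g ((D.pairing k).embA U) X).re := rfl

/-- Face: `EB k b g U X = Re E_B(pair X; b∷g; embB U)`. [cite: Balaban1988RG2Cluster, (2.13) p.14 (bookkeeping)] -/
theorem u3Objects_EB_apply (k : ℕ) (b : ℝ) (g : ℕ → ℝ) (U : (D.pairing k).BgB) (X : W1.Dom (F.P k) M) :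
    (D.u3Objects γ).EB k b g U X = (functionalC (D.S (k + 1)) (prependCoupling b g) ((D.pairing k).embB U) ((D.pairing k).pair X)).re := rfl

/-- Face: the letter block is the analytic block of the inputs. [cite: Balaban1987RG1, (1.20)-(1.22) p.264 (bookkeeping)] -/
theorem u3Objects_toU3Letters₁₁ : (D.u3Objects γ).toU3Letters₁₁ = D.li.analytic γ := rfl

/-- Face: level `k` of the reading IS level `k` of the fixed-carrier objects of its level-`k` data (carriers). [cite: Balaban1989LargeFieldII, (2.13)-(2.14) p.359 (bookkeeping)] -/
theorem u3Objects_levelCarriers_eq_ofFixed (k : ℕ) :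
    (D.u3Objects γ).levelCarriers k =
      (U3Objects₁₁.ofFixed (D.pairing k).carriers ((D.pairing k).EA (D.S k)) ((D.pairing k).EB (D.S (k + 1))) (D.li.analytic γ)).levelCarriers k :=
  rfl

/-- … (run A's functional). [cite: Balaban1989LargeFieldII, (2.13)-(2.14) p.359 (bookkeeping)] -/
theorem u3Objects_EA_eq_ofFixed (k : ℕ) :
    (D.u3Objects γ).EA k =
      (U3Objects₁₁.ofFixed (D.pairing k).carriers ((D.pairing k).EA (D.S k)) ((D.pairing k).EB (D.S (k + 1))) (D.li.analytic γ)).EA k :=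
  rfl

/-- … (run B's family). [cite: Balaban1989LargeFieldII, (2.13)-(2.14) p.359 (bookkeeping)] -/
theorem u3Objects_EB_eq_ofFixed (k : ℕ) :
    (D.u3Objects γ).EB k =
      (U3Objects₁₁.ofFixed (D.pairing k).carriers ((D.pairing k).EA (D.S k)) ((D.pairing k).EB (D.S (k + 1))) (D.li.analytic γ)).EB k :=
  rfl

/-- … (letters). [cite: Balaban1989LargeFieldII, (2.13)-(2.14) p.359 (bookkeeping)] -/
theorem u3Objects_toU3Letters₁₁_eq_ofFixed (k : ℕ) :
    (D.u3Objects γ).toU3Letters₁₁ =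
      (U3Objects₁₁.ofFixed (D.pairing k).carriers ((D.pairing k).EA (D.S k)) ((D.pairing k).EB (D.S (k + 1))) (D.li.analytic γ)).toU3Letters₁₁ :=
  rfl

/-- THE LETTER EQUATION `ω = θ₅^{1−s} μ^{s}` of the reading (`rfl`). [cite: Balaban1989LargeFieldII, (2.13)-(2.14) p.359 (bookkeeping)] -/
theorem u3Objects_ω : (D.u3Objects γ).ω = (D.u3Objects γ).θ₅ ^ (1 - D.li.s) * D.li.μ ^ D.li.s := rfl

/-- THE LETTER EQUATION FOR `C₉` of the reading (`rfl`). [cite: Balaban1989LargeFieldII, (2.13)-(2.14) p.359 (bookkeeping)] -/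
theorem u3Objects_C₉ :
    (D.u3Objects γ).C₉ =
      32 / (D.li.s ^ 2 * min (D.li.r / 2) (γ / 2)) * (D.li.C₀ ^ (1 - D.li.s) * (2 * D.li.A) ^ D.li.s) / ((D.u3Objects γ).θ₅ ^ (1 - D.li.s) * D.li.μ ^ D.li.s) :=
  rfl

/-- **(P) FOR THE READING — NO HYPOTHESIS**: run A's level functional reads `g₀, …, g_{j−1}` only at `(j, X)`, on every window (W1's
`functionalOn_prefixDependenceOn`). [cite: Balaban1987RG1, §0 p.256 and §5 p.298] -/
theorem prefixDependenceOn_u3Objects_EA (k : ℕ) (W : Set (ℕ → ℝ)) : PrefixDependenceOn ((D.u3Objects γ).EA k) W :=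
  functionalOn_prefixDependenceOn (D.S k) _ _ W

/-- No term at creation step `0` for the reading's level functionals. [cite: Balaban1987RG1, (0.23) p.256] -/
theorem scaleZeroFree_u3Objects_EA (k : ℕ) (W : Set (ℕ → ℝ)) : ScaleZeroFree ((D.u3Objects γ).EA k) W :=
  functionalOn_scaleZeroFree (D.S k) _ _ W

/-- **THE READING's U3 OBJECTS ARE POPULATED — UNCONDITIONALLY** (RR-1 v1.1 §8 `U3Objects₁₁.Populated`): every level's domain type `Σ j, 𝐃_j(F.P k)`
holds the single cube of creation step `0` (`Sect2.cubeDom`).  Populatedness of the U3 layer therefore carries NO content for a W1 reading (the content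
residual is the VALUE of the towers' terms, §6). [cite: Balaban1987RG1, p.257 (the cubes π_j ⊂ 𝐃_j; display of non-degeneracy)] -/
theorem u3Objects_populated : (D.u3Objects γ).Populated :=
  fun k => ⟨(⟨0, cubeDom (F.P k) M 0 fun _ => 0⟩ : W1.Dom (F.P k) M)⟩

/-- **NE5 READ ON THE READING's LEVEL-`k` OBJECTS** (`Iff.rfl`): `T4OutputRate.NE5 (EA k) (EB k b) W κ θ C₅` IS, for every history `g ∈ W`, run-B background `U`
and run-A domain `(j, X)`, `|Re E_A^{(j)}(X; g; embA (transport U)) − Re E_B(pair (j, X); b∷g; embB U)| ≤ C₅ · θ ^ j · e^{−κ·d_j(X)}` — dag-n18-d §6's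
right-hand side, per run length. [cite: Balaban1987RG1, Thm 1 p.259 and (1.18) p.263 (NE5 is NOT printed; bookkeeping)] -/
theorem ne5_u3Objects_iff (k : ℕ) (b : ℝ) (W : Set (ℕ → ℝ)) (κ θ C₅ : ℝ) :
    NE5 ((D.u3Objects γ).EA k) ((D.u3Objects γ).EB k b) W κ θ C₅ ↔
      ∀ g ∈ W, ∀ (U : (D.pairing k).BgB) (X : W1.Dom (F.P k) M),
        |(functionalC (D.S k) g ((D.pairing k).embA ((D.pairing k).transport U)) X).re -
            (functionalC (D.S (k + 1)) (prependCoupling b g) ((D.pairing k).embB U) ((D.pairing k).pair X)).re| ≤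
          C₅ * θ ^ X.1 * Real.exp (-(κ * (domSys (F.P k) M X.1).dj X.2)) :=
  Iff.rfl

/-- **NE9 READ ON THE READING's LEVEL-`k` FUNCTIONAL** (`Iff.rfl`): the history-Lipschitz inequality for `Re E^{(j)}(X; ·; embA U)` with moduli `Λ`.
[cite: Balaban1987RG1, (1.18) p.263 and §5 p.298 (NE9 is NOT printed; bookkeeping)] -/
theorem ne9_u3Objects_iff (k : ℕ) (W : Set (ℕ → ℝ)) (κ : ℝ) (Λ : ℕ → ℕ → ℝ) :
    NE9 (C := (D.u3Objects γ).levelCarriers k) ((D.u3Objects γ).EA k) W κ Λ ↔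
      ∀ g ∈ W, ∀ g' ∈ W, ∀ (U : (D.pairing k).BgA) (X : W1.Dom (F.P k) M),
        |(functionalC (D.S k) g ((D.pairing k).embA U) X).re - (functionalC (D.S k) g' ((D.pairing k).embA U) X).re| ≤
          Real.exp (-(κ * (domSys (F.P k) M X.1).dj X.2)) * ∑ i ∈ Finset.range X.1, Λ X.1 i * |g i - g' i| :=
  Iff.rfl

end ReadingData

/-! ## §4  The keyed assignments — the Literature half of the named reading `𝔯_W1` at the ₁₂ home (primary) and at the ₁₁ home -/

/-- **THE RESIDUAL INPUTS OF THE W1 RATE ASSIGNMENT AT THE ₁₂ HOME, colour `N`**: per `(F, θ : Stage12Params F N)` the W1 reading data on `𝔸 = M_N(ℂ)` with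
the cube size OF THE RECORD `θ.τ9.M` (towers, pairings, letter inputs — W1's side; NO proviso is read), and per `(F, θ, g₀, os)` N16's NE3 objects and N15's
NE2 objects at each run length (NOT W1's: residual, pinned by their definers).  EXPLICIT parameters; no law assumed.
[cite: Balaban1987RG1, (0.24)-(0.25) p.257 and (1.18)-(1.22) pp.263-264 (objects only)] -/
structure AssignmentInputs₁₂ (N : ℕ) [NeZero N] where
  /-- W1's reading data per `(F, θ)` -/
  w1 : (F : T4Family) → (θ : Stage12Params F N) → ReadingData F (MatA N) θ.τ9.M
  /-- N16's single-scale objects per `(F, θ, g₀, os)` and run length -/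
  ne3 : (F : T4Family) → Stage12Params F N → (ℕ → ℝ) → List (ULoop F) → ℕ → NE3Objects₁₁ N
  /-- N15's single-scale objects per `(F, θ, g₀, os)` and run length -/
  ne2 : (F : T4Family) → Stage12Params F N → (ℕ → ℝ) → List (ULoop F) → ℕ → NE2Objects₁₁

/-- **THE RESIDUAL INPUTS OF THE W1 RATE ASSIGNMENT AT THE ₁₁ HOME** (same shape over `Stage11Params`; the ₁₁ datum keys are uninhabited —
`Node00.not_isRecordOfRecord₁₁C` — so the ₁₁ home's node statements are located-vacuous; the key is kept for the ₁₁ consumer modules as they stand).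
[cite: Balaban1987RG1, (0.24)-(0.25) p.257 and (1.18)-(1.22) pp.263-264 (objects only)] -/
structure AssignmentInputs₁₁ (N : ℕ) [NeZero N] where
  /-- W1's reading data per `(F, θ)` -/
  w1 : (F : T4Family) → (θ : Stage11Params F N) → ReadingData F (MatA N) θ.τ9.M
  /-- N16's single-scale objects per `(F, θ, g₀, os)` and run length -/
  ne3 : (F : T4Family) → Stage11Params F N → (ℕ → ℝ) → List (ULoop F) → ℕ → NE3Objects₁₁ N
  /-- N15's single-scale objects per `(F, θ, g₀, os)` and run length -/
  ne2 : (F : T4Family) → Stage11Params F N → (ℕ → ℝ) → List (ULoop F) → ℕ → NE2Objects₁₁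

variable {N : ℕ} [NeZero N]

/-- **THE W1 RATE ASSIGNMENT AT THE ₁₂ HOME** — the Literature half of the named reading `𝔯_W1` (layer B ₁₂: `RateReading₁₂.ofAssignment (W1.assignment₁₂ 𝔇) ne1`;
the value type IS RR-2's proviso-free `RateAssignment₁₂ N`, spelled out): at `(F, θ, g₀, os)` node U3's objects ARE the W1 reading's at window radius `θ.γ`, the
single-scale layers the inputs'. [cite: Balaban1987RG1, (0.24)-(0.25) p.257 and (1.18)-(1.22) pp.263-264 (objects only)] -/
def assignment₁₂ (𝔇 : AssignmentInputs₁₂ N) : (F : T4Family) → Stage12Params F N → (ℕ → ℝ) → List (ULoop F) → RateObjects₁₁ N :=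
  fun F θ g₀ os => ⟨(𝔇.w1 F θ).u3Objects θ.γ, 𝔇.ne3 F θ g₀ os, 𝔇.ne2 F θ g₀ os⟩

/-- **THE W1 RATE ASSIGNMENT AT THE ₁₁ HOME** (`RateAssignment₁₁ N`; consumers' `𝔯_W1 := ⟨W1.assignment₁₁ 𝔇, ne1⟩ : RateReading₁₁ N`).
[cite: Balaban1987RG1, (0.24)-(0.25) p.257 and (1.18)-(1.22) pp.263-264 (objects only)] -/
def assignment₁₁ (𝔇 : AssignmentInputs₁₁ N) : RateAssignment₁₁ N :=
  fun F θ g₀ os => ⟨(𝔇.w1 F θ).u3Objects θ.γ, 𝔇.ne3 F θ g₀ os, 𝔇.ne2 F θ g₀ os⟩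

/-! ## §5  Faces and proved glue on the keyed assignments (what the N18 ∕ N22 one-application faces at `RRec₁₂` ∕ `RRec₁₁` consume) -/

section Faces12

variable (𝔇 : AssignmentInputs₁₂ N) (F : T4Family) (θ : Stage12Params F N) (g₀ : ℕ → ℝ) (os : List (ULoop F)) (k : ℕ)

/-- Face: node U3's objects of the ₁₂ assignment are the W1 reading's. [cite: Balaban1987RG1, (0.24)-(0.25) p.257 (bookkeeping)] -/
theorem assignment₁₂_u3 : (assignment₁₂ 𝔇 F θ g₀ os).u3 = (𝔇.w1 F θ).u3Objects θ.γ := rfl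

/-- Face: N16's layer. [cite: Balaban1985UV3, (1)-(3) p.256 (bookkeeping)] -/
theorem assignment₁₂_ne3 : (assignment₁₂ 𝔇 F θ g₀ os).ne3 = 𝔇.ne3 F θ g₀ os := rfl

/-- Face: N15's layer. [cite: King1986, Prop. 3.9 (3.73) p.665 (bookkeeping)] -/
theorem assignment₁₂_ne2 : (assignment₁₂ 𝔇 F θ g₀ os).ne2 = 𝔇.ne2 F θ g₀ os := rfl

/-- Face: the level-`k` carriers ARE W1's carriers of record of the `k`-th torus with the cube size of the record. [cite: Balaban1987RG1, (0.24)-(0.25) p.257 (bookkeeping)] -/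
theorem assignment₁₂_levelCarriers :
    (assignment₁₂ 𝔇 F θ g₀ os).u3.levelCarriers k = histCarriers (F.P k) θ.τ9.M ((𝔇.w1 F θ).pairing k).toRunPairing := rfl

/-- **THE PIN**: run A's level-`k` functional of the ₁₂ assignment IS W1's (2.13) functional `W1.functionalOn (S k) _ embA`. [cite: Balaban1988RG2Cluster, (2.13) p.14; Balaban1987RG1, (0.24) p.257] -/
theorem assignment₁₂_EA :
    (assignment₁₂ 𝔇 F θ g₀ os).u3.EA k = functionalOn ((𝔇.w1 F θ).S k) ((𝔇.w1 F θ).pairing k).toRunPairing ((𝔇.w1 F θ).pairing k).embA := rfl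

/-- … pointwise: `Re E^{(j)}(X; g; embA U)`. [cite: Balaban1988RG2Cluster, (2.13) p.14 (bookkeeping)] -/
theorem assignment₁₂_EA_apply (g : ℕ → ℝ) (U : ((𝔇.w1 F θ).pairing k).BgA) (X : W1.Dom (F.P k) θ.τ9.M) :
    (assignment₁₂ 𝔇 F θ g₀ os).u3.EA k g U X = (functionalC ((𝔇.w1 F θ).S k) g (((𝔇.w1 F θ).pairing k).embA U) X).re := rfl

/-- **THE PIN, run B**: `EB k b g U X = Re E_B(pair X; b∷g; embB U)` for the `(k+1)`-run's tower. [cite: Balaban1988RG2Cluster, (2.13) p.14; Balaban1987RG1, (0.25) p.257] -/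
theorem assignment₁₂_EB_apply (b : ℝ) (g : ℕ → ℝ) (U : ((𝔇.w1 F θ).pairing k).BgB) (X : W1.Dom (F.P k) θ.τ9.M) :
    (assignment₁₂ 𝔇 F θ g₀ os).u3.EB k b g U X =
      (functionalC ((𝔇.w1 F θ).S (k + 1)) (prependCoupling b g) (((𝔇.w1 F θ).pairing k).embB U) (((𝔇.w1 F θ).pairing k).pair X)).re := rfl

/-- Face: the letter block of the ₁₂ assignment is the analytic block of the inputs at `θ.γ`. [cite: Balaban1987RG1, (1.20)-(1.22) p.264 (bookkeeping)] -/
theorem assignment₁₂_toU3Letters₁₁ : (assignment₁₂ 𝔇 F θ g₀ os).u3.toU3Letters₁₁ = (𝔇.w1 F θ).li.analytic θ.γ := rfl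

/-- **THE LETTER EQUATION FOR `ω`** in the literal of the analytic slot (`rfl`). [cite: Balaban1989LargeFieldII, (2.13)-(2.14) p.359 (bookkeeping)] -/
theorem assignment₁₂_ω :
    (assignment₁₂ 𝔇 F θ g₀ os).u3.ω = (assignment₁₂ 𝔇 F θ g₀ os).u3.θ₅ ^ (1 - (𝔇.w1 F θ).li.s) * (𝔇.w1 F θ).li.μ ^ (𝔇.w1 F θ).li.s := rfl

/-- **THE LETTER EQUATION FOR `C₉`** in the literal of the analytic slot, window radius `θ.γ` (`rfl`). [cite: Balaban1989LargeFieldII, (2.13)-(2.14) p.359 (bookkeeping)] -/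
theorem assignment₁₂_C₉ :
    (assignment₁₂ 𝔇 F θ g₀ os).u3.C₉ =
      32 / ((𝔇.w1 F θ).li.s ^ 2 * min ((𝔇.w1 F θ).li.r / 2) (θ.γ / 2)) *
          ((𝔇.w1 F θ).li.C₀ ^ (1 - (𝔇.w1 F θ).li.s) * (2 * (𝔇.w1 F θ).li.A) ^ (𝔇.w1 F θ).li.s) /
        ((assignment₁₂ 𝔇 F θ g₀ os).u3.θ₅ ^ (1 - (𝔇.w1 F θ).li.s) * (𝔇.w1 F θ).li.μ ^ (𝔇.w1 F θ).li.s) :=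
  rfl

/-- Face: the moduli are `C₉·ω^{k−i}` of the block (layer A's shape). [cite: Balaban1989LargeFieldII, (2.13)-(2.14) p.359 (bookkeeping)] -/
theorem assignment₁₂_moduli (i : ℕ) :
    (assignment₁₂ 𝔇 F θ g₀ os).u3.moduli k i = (assignment₁₂ 𝔇 F θ g₀ os).u3.C₉ * (assignment₁₂ 𝔇 F θ g₀ os).u3.ω ^ (k - i) := rfl

/-- **(P) AT THE ₁₂ ASSIGNMENT — NO HYPOTHESIS**, for every window. [cite: Balaban1987RG1, §0 p.256 and §5 p.298] -/
theorem prefixDependenceOn_assignment₁₂_EA (W : Set (ℕ → ℝ)) : PrefixDependenceOn ((assignment₁₂ 𝔇 F θ g₀ os).u3.EA k) W :=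
  (𝔇.w1 F θ).prefixDependenceOn_u3Objects_EA θ.γ k W

/-- `ScaleZeroFree` at the ₁₂ assignment. [cite: Balaban1987RG1, (0.23) p.256] -/
theorem scaleZeroFree_assignment₁₂_EA (W : Set (ℕ → ℝ)) : ScaleZeroFree ((assignment₁₂ 𝔇 F θ g₀ os).u3.EA k) W :=
  (𝔇.w1 F θ).scaleZeroFree_u3Objects_EA θ.γ k W

/-- The U3 layer of the ₁₂ assignment is populated (unconditionally). [cite: Balaban1987RG1, p.257 (display of non-degeneracy)] -/
theorem assignment₁₂_u3_populated : (assignment₁₂ 𝔇 F θ g₀ os).u3.Populated :=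
  (𝔇.w1 F θ).u3Objects_populated θ.γ

/-- Hence the ₁₂ assignment's objects are populated iff N16's and N15's layers are. [cite: Balaban1987RG1, (1.18)-(1.22) pp.263-264 (display of non-degeneracy)] -/
theorem assignment₁₂_populated_iff :
    (assignment₁₂ 𝔇 F θ g₀ os).Populated ↔ (∀ k, (𝔇.ne3 F θ g₀ os k).Populated) ∧ ∀ k, (𝔇.ne2 F θ g₀ os k).Populated :=
  ⟨fun h => h.2, fun h => ⟨assignment₁₂_u3_populated 𝔇 F θ g₀ os, h⟩⟩

/-- **NE5 AT THE ₁₂ ASSIGNMENT's LEVEL `k` WITH ITS OWN LETTERS** (`Iff.rfl`; what `S_N18 (RRec₁₂ 𝔯_W1)` says per member `b` at a key).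
[cite: Balaban1987RG1, Thm 1 p.259 and (1.18) p.263 (NE5 is NOT printed; bookkeeping)] -/
theorem ne5_assignment₁₂_iff (b : ℝ) (W : Set (ℕ → ℝ)) :
    NE5 ((assignment₁₂ 𝔇 F θ g₀ os).u3.EA k) ((assignment₁₂ 𝔇 F θ g₀ os).u3.EB k b) W (assignment₁₂ 𝔇 F θ g₀ os).u3.κ
        (assignment₁₂ 𝔇 F θ g₀ os).u3.θ₅ (assignment₁₂ 𝔇 F θ g₀ os).u3.C₅ ↔
      ∀ g ∈ W, ∀ (U : ((𝔇.w1 F θ).pairing k).BgB) (X : W1.Dom (F.P k) θ.τ9.M),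
        |(functionalC ((𝔇.w1 F θ).S k) g (((𝔇.w1 F θ).pairing k).embA (((𝔇.w1 F θ).pairing k).transport U)) X).re -
            (functionalC ((𝔇.w1 F θ).S (k + 1)) (prependCoupling b g) (((𝔇.w1 F θ).pairing k).embB U) (((𝔇.w1 F θ).pairing k).pair X)).re| ≤
          (𝔇.w1 F θ).li.C₅ * (𝔇.w1 F θ).li.θ₅ ^ X.1 * Real.exp (-((𝔇.w1 F θ).li.κ * (domSys (F.P k) θ.τ9.M X.1).dj X.2)) :=
  Iff.rfl

/-- **NE9 AT THE ₁₂ ASSIGNMENT's LEVEL `k`** with moduli `Λ` (`Iff.rfl`; at `Λ := u3.moduli` it is what `S_N22 (RRec₁₂ 𝔯_W1)` says at a key).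
[cite: Balaban1987RG1, (1.18) p.263 and §5 p.298 (NE9 is NOT printed; bookkeeping)] -/
theorem ne9_assignment₁₂_iff (W : Set (ℕ → ℝ)) (κ : ℝ) (Λ : ℕ → ℕ → ℝ) :
    NE9 (C := (assignment₁₂ 𝔇 F θ g₀ os).u3.levelCarriers k) ((assignment₁₂ 𝔇 F θ g₀ os).u3.EA k) W κ Λ ↔
      ∀ g ∈ W, ∀ g' ∈ W, ∀ (U : ((𝔇.w1 F θ).pairing k).BgA) (X : W1.Dom (F.P k) θ.τ9.M),
        |(functionalC ((𝔇.w1 F θ).S k) g (((𝔇.w1 F θ).pairing k).embA U) X).re -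
            (functionalC ((𝔇.w1 F θ).S k) g' (((𝔇.w1 F θ).pairing k).embA U) X).re| ≤
          Real.exp (-(κ * (domSys (F.P k) θ.τ9.M X.1).dj X.2)) * ∑ i ∈ Finset.range X.1, Λ X.1 i * |g i - g' i| :=
  Iff.rfl

end Faces12

section Faces11

variable (𝔇 : AssignmentInputs₁₁ N) (F : T4Family) (θ : Stage11Params F N) (g₀ : ℕ → ℝ) (os : List (ULoop F)) (k : ℕ)

/-- Face: node U3's objects of the ₁₁ assignment are the W1 reading's. [cite: Balaban1987RG1, (0.24)-(0.25) p.257 (bookkeeping)] -/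
theorem assignment₁₁_u3 : (assignment₁₁ 𝔇 F θ g₀ os).u3 = (𝔇.w1 F θ).u3Objects θ.γ := rfl

/-- Face: the level-`k` carriers. [cite: Balaban1987RG1, (0.24)-(0.25) p.257 (bookkeeping)] -/
theorem assignment₁₁_levelCarriers :
    (assignment₁₁ 𝔇 F θ g₀ os).u3.levelCarriers k = histCarriers (F.P k) θ.τ9.M ((𝔇.w1 F θ).pairing k).toRunPairing := rfl

/-- **THE PIN** at ₁₁: `EA k = W1.functionalOn (S k) _ embA`. [cite: Balaban1988RG2Cluster, (2.13) p.14; Balaban1987RG1, (0.24) p.257] -/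
theorem assignment₁₁_EA :
    (assignment₁₁ 𝔇 F θ g₀ os).u3.EA k = functionalOn ((𝔇.w1 F θ).S k) ((𝔇.w1 F θ).pairing k).toRunPairing ((𝔇.w1 F θ).pairing k).embA := rfl

/-- … pointwise. [cite: Balaban1988RG2Cluster, (2.13) p.14 (bookkeeping)] -/
theorem assignment₁₁_EA_apply (g : ℕ → ℝ) (U : ((𝔇.w1 F θ).pairing k).BgA) (X : W1.Dom (F.P k) θ.τ9.M) :
    (assignment₁₁ 𝔇 F θ g₀ os).u3.EA k g U X = (functionalC ((𝔇.w1 F θ).S k) g (((𝔇.w1 F θ).pairing k).embA U) X).re := rfl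

/-- **THE PIN, run B** at ₁₁. [cite: Balaban1988RG2Cluster, (2.13) p.14; Balaban1987RG1, (0.25) p.257] -/
theorem assignment₁₁_EB_apply (b : ℝ) (g : ℕ → ℝ) (U : ((𝔇.w1 F θ).pairing k).BgB) (X : W1.Dom (F.P k) θ.τ9.M) :
    (assignment₁₁ 𝔇 F θ g₀ os).u3.EB k b g U X =
      (functionalC ((𝔇.w1 F θ).S (k + 1)) (prependCoupling b g) (((𝔇.w1 F θ).pairing k).embB U) (((𝔇.w1 F θ).pairing k).pair X)).re := rfl

/-- **THE LETTER EQUATION FOR `ω`** at ₁₁ in the literal of `YMDAG.N22.s_N22_rRec₁₁_of_oscAnalytic` (`rfl`). [cite: Balaban1989LargeFieldII, (2.13)-(2.14) p.359 (bookkeeping)] -/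
theorem assignment₁₁_ω :
    (assignment₁₁ 𝔇 F θ g₀ os).u3.ω = (assignment₁₁ 𝔇 F θ g₀ os).u3.θ₅ ^ (1 - (𝔇.w1 F θ).li.s) * (𝔇.w1 F θ).li.μ ^ (𝔇.w1 F θ).li.s := rfl

/-- **THE LETTER EQUATION FOR `C₉`** at ₁₁ in the literal of `YMDAG.N22.s_N22_rRec₁₁_of_oscAnalytic`, window radius `θ.γ` (`rfl`).
[cite: Balaban1989LargeFieldII, (2.13)-(2.14) p.359 (bookkeeping)] -/
theorem assignment₁₁_C₉ :
    (assignment₁₁ 𝔇 F θ g₀ os).u3.C₉ =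
      32 / ((𝔇.w1 F θ).li.s ^ 2 * min ((𝔇.w1 F θ).li.r / 2) (θ.γ / 2)) *
          ((𝔇.w1 F θ).li.C₀ ^ (1 - (𝔇.w1 F θ).li.s) * (2 * (𝔇.w1 F θ).li.A) ^ (𝔇.w1 F θ).li.s) /
        ((assignment₁₁ 𝔇 F θ g₀ os).u3.θ₅ ^ (1 - (𝔇.w1 F θ).li.s) * (𝔇.w1 F θ).li.μ ^ (𝔇.w1 F θ).li.s) :=
  rfl

/-- **(P) AT THE ₁₁ ASSIGNMENT — NO HYPOTHESIS** (slot hypothesis `hP` of `YMDAG.N22.s_N22_rRec₁₁_of_osc…`). [cite: Balaban1987RG1, §0 p.256 and §5 p.298] -/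
theorem prefixDependenceOn_assignment₁₁_EA (W : Set (ℕ → ℝ)) : PrefixDependenceOn ((assignment₁₁ 𝔇 F θ g₀ os).u3.EA k) W :=
  (𝔇.w1 F θ).prefixDependenceOn_u3Objects_EA θ.γ k W

/-- `ScaleZeroFree` at the ₁₁ assignment. [cite: Balaban1987RG1, (0.23) p.256] -/
theorem scaleZeroFree_assignment₁₁_EA (W : Set (ℕ → ℝ)) : ScaleZeroFree ((assignment₁₁ 𝔇 F θ g₀ os).u3.EA k) W :=
  (𝔇.w1 F θ).scaleZeroFree_u3Objects_EA θ.γ k W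

/-- The U3 layer of the ₁₁ assignment is populated (unconditionally); so `RateAssignment₁₁.Populated (assignment₁₁ 𝔇)` is the NE3 ∕ NE2 layers' populatedness.
[cite: Balaban1987RG1, p.257 (display of non-degeneracy)] -/
theorem assignment₁₁_u3_populated : (assignment₁₁ 𝔇 F θ g₀ os).u3.Populated :=
  (𝔇.w1 F θ).u3Objects_populated θ.γ

/-- **NE5 AT THE ₁₁ ASSIGNMENT's LEVEL `k` WITH ITS OWN LETTERS** (`Iff.rfl`; with `YMDAG.N18.HLayer.s_N18_rRec₁₁_of_forall_ne5` the one application).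
[cite: Balaban1987RG1, Thm 1 p.259 and (1.18) p.263 (NE5 is NOT printed; bookkeeping)] -/
theorem ne5_assignment₁₁_iff (b : ℝ) (W : Set (ℕ → ℝ)) :
    NE5 ((assignment₁₁ 𝔇 F θ g₀ os).u3.EA k) ((assignment₁₁ 𝔇 F θ g₀ os).u3.EB k b) W (assignment₁₁ 𝔇 F θ g₀ os).u3.κ
        (assignment₁₁ 𝔇 F θ g₀ os).u3.θ₅ (assignment₁₁ 𝔇 F θ g₀ os).u3.C₅ ↔
      ∀ g ∈ W, ∀ (U : ((𝔇.w1 F θ).pairing k).BgB) (X : W1.Dom (F.P k) θ.τ9.M),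
        |(functionalC ((𝔇.w1 F θ).S k) g (((𝔇.w1 F θ).pairing k).embA (((𝔇.w1 F θ).pairing k).transport U)) X).re -
            (functionalC ((𝔇.w1 F θ).S (k + 1)) (prependCoupling b g) (((𝔇.w1 F θ).pairing k).embB U) (((𝔇.w1 F θ).pairing k).pair X)).re| ≤
          (𝔇.w1 F θ).li.C₅ * (𝔇.w1 F θ).li.θ₅ ^ X.1 * Real.exp (-((𝔇.w1 F θ).li.κ * (domSys (F.P k) θ.τ9.M X.1).dj X.2)) :=
  Iff.rfl

end Faces11

/-! ## §6  Honesty in the kernel: INHABITATION IS NOT CONTENT (the termless towers); class consistency -/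

section Sanity

open Literature.Probability.LatticeModels (polymerRayDeriv polymerLogZ truncatedWeight)

/-- The ray derivative of the zero activity vanishes (local copy of the `PSStability` lemma, which is not imported here). [folklore] -/
private theorem polymerRayDeriv_zero' {Q : Type*} [DecidableEq Q] (inc : Q → Q → Prop) [DecidableRel inc] (Λ : Finset Q) (t : ℝ) :
    polymerRayDeriv inc (fun _ => (0 : ℂ)) Λ t = 0 := by
  refine Finset.sum_eq_zero fun X _ => ?_
  rcases X.eq_empty_or_nonempty with rfl | ⟨γ, hγ⟩
  · simp
  · rw [Finset.prod_eq_zero hγ rfl, mul_zero]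

/-- The Kotecký–Preiss logarithm of the zero activity vanishes. [folklore] -/
private theorem polymerLogZ_zero' {Q : Type*} [DecidableEq Q] (inc : Q → Q → Prop) [DecidableRel inc] (Λ : Finset Q) :
    polymerLogZ inc (fun _ => (0 : ℂ)) Λ = 0 := by
  unfold polymerLogZ
  simp [polymerRayDeriv_zero']

/-- The truncated functional of the zero activity vanishes. [folklore] -/
private theorem truncatedWeight_zero' {Q : Type*} [DecidableEq Q] (inc : Q → Q → Prop) [DecidableRel inc] (C : Finset Q) :
    truncatedWeight inc (fun _ => (0 : ℂ)) C = 0 := by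
  unfold truncatedWeight
  simp [polymerLogZ_zero']

/-- **THE TERMLESS TOWER** (no indices at any step: the (2.11) sums are empty, `H ≡ 0`) — plumbing and the honesty witness below; NOT NODE 00's terms.
[cite: Balaban1988RG2Cluster, (2.11) p.14 (bookkeeping; the empty instance)] -/
def termlessTower (P : Params) (𝔸 : Type*) (M : ℕ) : ClusterTower P 𝔸 M :=
  fun _ => ⟨Empty, fun _ => ∅, fun i => i.elim⟩

/-- The termless step's activity vanishes. [cite: Balaban1988RG2Cluster, (2.11) p.14 (bookkeeping)] -/
theorem H_termlessTower {P : Params} {𝔸 : Type*} {M : ℕ} (k : ℕ) (g : Fin (k + 1) → ℝ) (φ : CPair P 𝔸) (Z : (domSys P M (k + 1)).Dom) :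
    (termlessTower P 𝔸 M k).H g φ Z = 0 :=
  Finset.sum_empty

open Classical in
/-- (2.13) of the termless step vanishes: every truncated functional of the zero activity is `0`. [cite: Balaban1988RG2Cluster, (2.13) p.14 (bookkeeping)] -/
theorem E_termlessTower {P : Params} {𝔸 : Type*} {M : ℕ} (k : ℕ) (g : Fin (k + 1) → ℝ) (φ : CPair P 𝔸) (X : (domSys P M (k + 1)).Dom) :
    (termlessTower P 𝔸 M k).E g φ X = 0 := by
  rw [ClusterStep.E_eq_locE]
  refine (B13Resummation.locE_congr _ fun Z _ => H_termlessTower k g φ Z).trans ?_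
  unfold B13Resummation.locE
  exact Finset.sum_eq_zero fun C _ => truncatedWeight_zero' _ C

/-- Every term of the termless tower vanishes. [cite: Balaban1988RG2Cluster, (2.13) p.14 (bookkeeping)] -/
theorem termC_termlessTower {P : Params} {𝔸 : Type*} {M : ℕ} (j : ℕ) (X : (domSys P M j).Dom) (g : ℕ → ℝ) (φ : CPair P 𝔸) :
    termC (termlessTower P 𝔸 M) j X g φ = 0 := by
  cases j with
  | zero => rfl
  | succ k => exact E_termlessTower k _ φ X

/-- … so its (2.13) functional vanishes identically. [cite: Balaban1988RG2Cluster, (2.13) p.14 (bookkeeping)] -/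
theorem functionalC_termlessTower {P : Params} {𝔸 : Type*} {M : ℕ} (g : ℕ → ℝ) (φ : CPair P 𝔸) (X : W1.Dom P M) :
    functionalC (termlessTower P 𝔸 M) g φ X = 0 :=
  termC_termlessTower X.1 X.2 g φ

/-- One-point backgrounds read as the zero configuration, paired into the cube of step `0` — plumbing only. [folklore] -/
private def trivialPairing (F : T4Family) (𝔸 : Type*) [Zero 𝔸] (M k : ℕ) : LevelPairing F 𝔸 M k where
  BgA := Unit
  BgB := Unit
  gauge := fun _ _ => 0
  gauge_nonneg := fun _ _ => le_rfl
  transport := fun _ => ()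
  embA := fun _ => 0
  embB := fun _ => 0
  pair := fun _ => ⟨0, cubeDom (F.P (k + 1)) M 0 (fun _ => 0)⟩

/-- Zero letter inputs with `θ₅ = ρ = ½` — plumbing only. [folklore] -/
private def trivialLetterInputs : LetterInputs :=
  ⟨0, 1 / 2, 0, 0, 1 / 2, 0, 0, 0, 0, 0⟩

/-- Termless reading data — plumbing only. [folklore] -/
private def termlessReadingData (F : T4Family) (𝔸 : Type*) [Zero 𝔸] (M : ℕ) : ReadingData F 𝔸 M :=
  ⟨fun k => termlessTower (F.P k) 𝔸 M, fun k => trivialPairing F 𝔸 M k, trivialLetterInputs⟩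

/-- The reading-data container is inhabited for any coefficient algebra with a zero (class consistency only; NO content). [cite: Balaban1987RG1, (0.24)-(0.25) p.257 (bookkeeping)] -/
theorem nonempty_readingData (F : T4Family) (𝔸 : Type*) [Zero 𝔸] (M : ℕ) : Nonempty (ReadingData F 𝔸 M) :=
  ⟨termlessReadingData F 𝔸 M⟩

variable (N)

/-- The ₁₂ input container is inhabited (class consistency only; NO content). [cite: Balaban1987RG1, (1.18)-(1.22) pp.263-264 (bookkeeping)] -/
theorem nonempty_assignmentInputs₁₂ : Nonempty (AssignmentInputs₁₂ N) :=
  let ⟨o⟩ := nonempty_rateObjects₁₁ N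
  ⟨⟨fun F θ => termlessReadingData F (MatA N) θ.τ9.M, fun _ _ _ _ => o.ne3, fun _ _ _ _ => o.ne2⟩⟩

/-- The ₁₁ input container is inhabited (class consistency only; NO content). [cite: Balaban1987RG1, (1.18)-(1.22) pp.263-264 (bookkeeping)] -/
theorem nonempty_assignmentInputs₁₁ : Nonempty (AssignmentInputs₁₁ N) :=
  let ⟨o⟩ := nonempty_rateObjects₁₁ N
  ⟨⟨fun F θ => termlessReadingData F (MatA N) θ.τ9.M, fun _ _ _ _ => o.ne3, fun _ _ _ _ => o.ne2⟩⟩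

/-- **INHABITATION IS NOT CONTENT** (ref-H WATCH-W1-DEGENERATE one level down, in the kernel): there is a ₁₂ input datum — the termless towers — whose
assignment has a POPULATED U3 layer and IDENTICALLY VANISHING level functionals `EA k ≡ 0`, `EB k b ≡ 0` at every key; for it NE5 ∕ NE9 ∕ (O) ∕ (A) hold
with nothing proved.  A discharge keyed to `𝔯_W1 = ⟨W1.assignment₁₂ 𝔇, ne1⟩` therefore NAMES its `𝔇` and owes the identification of `𝔇`'s towers with the
(2.14) terms of the construction (N10's Lemmas 1–3 objects) — LOCATED, not content. [cite: Balaban1988RG2Cluster, (2.13)-(2.14) pp.14-15 (bookkeeping; display of degeneracy)] -/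
theorem exists_assignmentInputs₁₂_populated_functionals_zero :
    ∃ 𝔇 : AssignmentInputs₁₂ N, ∀ (F : T4Family) (θ : Stage12Params F N) (g₀ : ℕ → ℝ) (os : List (ULoop F)) (k : ℕ),
      (assignment₁₂ 𝔇 F θ g₀ os).u3.Populated ∧
      (∀ (g : ℕ → ℝ) (U : ((assignment₁₂ 𝔇 F θ g₀ os).u3.levelCarriers k).BgA) (X : ((assignment₁₂ 𝔇 F θ g₀ os).u3.levelCarriers k).Dom),
          (assignment₁₂ 𝔇 F θ g₀ os).u3.EA k g U X = 0) ∧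
      (∀ (b : ℝ) (g : ℕ → ℝ) (U : ((assignment₁₂ 𝔇 F θ g₀ os).u3.levelCarriers k).BgB) (X : ((assignment₁₂ 𝔇 F θ g₀ os).u3.levelCarriers k).Dom),
          (assignment₁₂ 𝔇 F θ g₀ os).u3.EB k b g U X = 0) ∧
      (∀ (b : ℝ) (W : Set (ℕ → ℝ)),
          NE5 ((assignment₁₂ 𝔇 F θ g₀ os).u3.EA k) ((assignment₁₂ 𝔇 F θ g₀ os).u3.EB k b) W (assignment₁₂ 𝔇 F θ g₀ os).u3.κ
            (assignment₁₂ 𝔇 F θ g₀ os).u3.θ₅ (assignment₁₂ 𝔇 F θ g₀ os).u3.C₅) ∧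
      ∀ (W : Set (ℕ → ℝ)) (κ : ℝ) (Λ : ℕ → ℕ → ℝ), (∀ a i, 0 ≤ Λ a i) →
          NE9 (C := (assignment₁₂ 𝔇 F θ g₀ os).u3.levelCarriers k) ((assignment₁₂ 𝔇 F θ g₀ os).u3.EA k) W κ Λ := by
  obtain ⟨o⟩ := nonempty_rateObjects₁₁ N
  refine ⟨⟨fun F θ => termlessReadingData F (MatA N) θ.τ9.M, fun _ _ _ _ => o.ne3, fun _ _ _ _ => o.ne2⟩, fun F θ g₀ os k => ?_⟩
  have hA : ∀ (g : ℕ → ℝ) (U : Unit) (X : W1.Dom (F.P k) θ.τ9.M),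
      (assignment₁₂ ⟨fun F θ => termlessReadingData F (MatA N) θ.τ9.M, fun _ _ _ _ => o.ne3, fun _ _ _ _ => o.ne2⟩ F θ g₀ os).u3.EA k g U X = 0 :=
    fun g U X => by
      show (functionalC (termlessTower (F.P k) (MatA N) θ.τ9.M) g 0 X).re = 0
      rw [functionalC_termlessTower, Complex.zero_re]
  have hB : ∀ (b : ℝ) (g : ℕ → ℝ) (U : Unit) (X : W1.Dom (F.P k) θ.τ9.M),
      (assignment₁₂ ⟨fun F θ => termlessReadingData F (MatA N) θ.τ9.M, fun _ _ _ _ => o.ne3, fun _ _ _ _ => o.ne2⟩ F θ g₀ os).u3.EB k b g U X = 0 :=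
    fun b g U X => by
      show (functionalC (termlessTower (F.P (k + 1)) (MatA N) θ.τ9.M) (prependCoupling b g) 0 ⟨0, cubeDom (F.P (k + 1)) θ.τ9.M 0 fun _ => 0⟩).re = 0
      rw [functionalC_termlessTower, Complex.zero_re]
  refine ⟨assignment₁₂_u3_populated _ F θ g₀ os, hA, hB, ?_, ?_⟩
  · intro b W g _ U X
    rw [hA, hB, sub_zero, abs_zero]
    show (0 : ℝ) ≤ 0 * _ * _
    simp
  · intro W κ Λ hΛ g _ g' _ U X
    rw [hA, hA, sub_zero, abs_zero]
    exact mul_nonneg (Real.exp_nonneg _) (Finset.sum_nonneg fun i _ => mul_nonneg (hΛ _ _) (abs_nonneg _))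

end Sanity

end W1

end Literature.MathematicalPhysics.QuantumFieldTheory.Balaban1983to89.Node00

end
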